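import Summits.RiemannHypothesis.RiemannHypothesis.Theorems.SoloInformedPeriodPieces

/-!
# Anatomy of fence visibility above resolution

(solo RiemannHypothesis/informed, session 4; memo `paper/sharpest.md` §2e (D7′).)

`SoloInformedFenceInvisibility` showed that for a window-`a` test `g = h·e^{−iγ₀t}` with `2a < T` the
vertical fence `ρ_k = ½ + u + i(γ₀ + 2πk/T)` satisfies `Σ_k Re(ĝ(ρ_k)·conj ĝ(ρ_k*)) = T‖h‖₂²`,
independently of the offset `u`.  Here the hypothesis `2a < T` is dropped: for `a ≤ N·T`,

  `Σ_k Re(ĝ(ρ_k)·conj ĝ(ρ_k*)) = T · Σ_{|d| ≤ 2N} e^{−udT} · Re ∫ h(s)·conj h(s + dT) ds`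

(`hasSum_re_weilMellin_pair_fence_lags`; the terms with `|d|T ≥ 2a` vanish).  So a RESOLVED fence
changes the Weil form, relative to critical zeros at the same heights (`u = 0`), only through the
autocorrelations of the test at the resolved lags `dT`, weighted by `e^{−udT} − 1`
(`hasSum_pairBlock_fence_sub_critical`; pairing `±d` the weights are `2(cosh(udT) − 1) ≥ 0`):
visibility of the offset requires NEGATIVE autocorrelation at a resolved lag, and the available gain
at the top lag `D ≈ 2a/T` is `≍ e^{2ua}` — the same exponential gain as the isolated-pair dipole of
`SoloInformedGroundStateDipole`.  The harmonic analysis (period pieces, polarized Parseval, lag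
regrouping) is in `SoloInformedPeriodPieces`; no property of `ζ` is used.
-/

open Complex MeasureTheory Set Filter
open Literature.NumberTheory.LFunctions
open scoped ComplexConjugate Real

namespace Summit.RiemannHypothesis.RiemannHypothesis.Theorems

section FenceAnatomy

variable {h : ℝ → ℂ} {a T : ℝ}

/-! ### The twisted dipole: autocorrelation form -/

/-- **Fence sum above resolution (anatomy).** For `h` continuous with `supp h ⊆ [−a, a]`, `0 < T`,
`a ≤ NT`, any offset `u` and height `γ₀`, `g = h·e^{−iγ₀t}` and `ρ_k = ½ + u + i(γ₀ + 2πk/T)`: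
`Σ_k Re(ĝ(ρ_k)·conj ĝ(1 − ρ̄_k)) = T·Σ_{|d|≤2N} e^{−udT}·∫ Re(h(s)·conj h(s + dT)) ds`.
For `2a < T` only `d = 0` survives (`hasSum_re_weilMellin_pair_fence`); in general the offset `u`
enters only through the weights `e^{−udT}` on the autocorrelations of `h` at the RESOLVED lags. -/
theorem hasSum_re_weilMellin_pair_fence_lags (hh : Continuous h) (hsupp : tsupport h ⊆ Icc (-a) a)
    (hT : 0 < T) (N : ℕ) (haN : a ≤ N * T) (u γ₀ : ℝ) :
    HasSum (fun k : ℤ ↦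
      (weilMellin (fun t ↦ h t * cexp (-(γ₀ * I) * t))
          (1 / 2 + u + ((γ₀ + 2 * π * k / T : ℝ) : ℂ) * I) *
        conj (weilMellin (fun t ↦ h t * cexp (-(γ₀ * I) * t))
          (1 - conj (1 / 2 + u + ((γ₀ + 2 * π * k / T : ℝ) : ℂ) * I)))).re)
      (T * ∑ d ∈ Finset.Icc (-(2 * N : ℤ)) (2 * N),
        Real.exp (-(u * d * T)) * ∫ s : ℝ, (h s * conj (h (s + d * T))).re) := by
  have hhc : HasCompactSupport h := isCompact_Icc.of_isClosed_subset (isClosed_tsupport h) hsupp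
  have hh0 : Function.support h ⊆ Icc (-a) a := fun x hx ↦ hsupp (subset_tsupport _ hx)
  have hsF : ∀ w : ℝ, Function.support (fun t : ℝ ↦ h t * cexp ((w : ℂ) * t)) ⊆ Icc (-a) a := by
    intro w x hx
    apply hh0
    rw [Function.mem_support] at hx ⊢
    intro h0
    exact hx (by rw [h0, zero_mul])
  have hcF : ∀ w : ℝ, Continuous fun t : ℝ ↦ h t * cexp ((w : ℂ) * t) :=
    fun w ↦ hh.mul (Complex.continuous_exp.comp (by fun_prop))
  have hkF : ∀ w : ℝ, HasCompactSupport fun t : ℝ ↦ h t * cexp ((w : ℂ) * t) :=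
    fun w ↦ hhc.mul_right
  have main := hasSum_re_integral_mul_conj_integral_lags hT N haN (hcF u) (hkF u) (hsF u)
    (hcF (-u)) (hkF (-u)) (hsF (-u))
  have e1 : (fun k : ℤ ↦
      (weilMellin (fun t ↦ h t * cexp (-(γ₀ * I) * t))
          (1 / 2 + u + ((γ₀ + 2 * π * k / T : ℝ) : ℂ) * I) *
        conj (weilMellin (fun t ↦ h t * cexp (-(γ₀ * I) * t))
          (1 - conj (1 / 2 + u + ((γ₀ + 2 * π * k / T : ℝ) : ℂ) * I)))).re) =
      fun k : ℤ ↦ ((∫ t : ℝ, cexp ((2 * π * k / T : ℝ) * I * t) * (h t * cexp ((u : ℂ) * t))) *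
        conj (∫ t : ℝ, cexp ((2 * π * k / T : ℝ) * I * t) *
          (h t * cexp (((-u : ℝ) : ℂ) * t)))).re := by
    ext k
    rw [one_sub_conj_half_add, weilMellin_twist_eq_integral, weilMellin_twist_eq_integral]
  have e3 : ∀ (d : ℤ) (s : ℝ), ((fun t : ℝ ↦ h t * cexp ((u : ℂ) * t)) s *
      conj ((fun t : ℝ ↦ h t * cexp (((-u : ℝ) : ℂ) * t)) (s + d * T))).re =
      Real.exp (-(u * d * T)) * (h s * conj (h (s + d * T))).re := by
    intro d s
    simp only
    rw [map_mul, ← Complex.exp_conj, map_mul, Complex.conj_ofReal, Complex.conj_ofReal]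
    have hexp : cexp ((u : ℂ) * s) * cexp (((-u : ℝ) : ℂ) * ((s + d * T : ℝ) : ℂ)) =
        ((Real.exp (-(u * d * T)) : ℝ) : ℂ) := by
      rw [← Complex.exp_add, Complex.ofReal_exp]
      congr 1
      push_cast
      ring
    calc (h s * cexp ((u : ℂ) * s) *
          (conj (h (s + d * T)) * cexp (((-u : ℝ) : ℂ) * ((s + d * T : ℝ) : ℂ)))).re
        = (((Real.exp (-(u * d * T)) : ℝ) : ℂ) * (h s * conj (h (s + d * T)))).re := by
          rw [← hexp]; congr 1; ring
      _ = Real.exp (-(u * d * T)) * (h s * conj (h (s + d * T))).re := by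
          rw [Complex.re_ofReal_mul]
  have e2 : (T * ∑ d ∈ Finset.Icc (-(2 * N : ℤ)) (2 * N), ∫ s : ℝ,
      ((fun t : ℝ ↦ h t * cexp ((u : ℂ) * t)) s *
        conj ((fun t : ℝ ↦ h t * cexp (((-u : ℝ) : ℂ) * t)) (s + d * T))).re) =
      T * ∑ d ∈ Finset.Icc (-(2 * N : ℤ)) (2 * N),
        Real.exp (-(u * d * T)) * ∫ s : ℝ, (h s * conj (h (s + d * T))).re := by
    congr 1
    refine Finset.sum_congr rfl fun d _ ↦ ?_
    rw [← integral_const_mul]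
    refine integral_congr_ae (Eventually.of_forall fun s ↦ ?_)
    exact e3 d s
  rw [e1, ← e2]
  exact main

/-- **Fence minus critical configuration.** With the notation of
`hasSum_re_weilMellin_pair_fence_lags`, the pair blocks of the fence at offset `u` exceed those of
double critical zeros at the same heights by
`2T·Σ_{|d|≤2N} (e^{−udT} − 1)·∫Re(h(s)conj h(s+dT))ds` (pairing `±d`: weights `2(cosh(udT) − 1) ≥ 0`);
the `d = 0` term vanishes, so only RESOLVED lags (`|d|T < 2a`) contribute. -/
theorem hasSum_pairBlock_fence_sub_critical (hh : Continuous h) (hsupp : tsupport h ⊆ Icc (-a) a)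
    (hT : 0 < T) (N : ℕ) (haN : a ≤ N * T) (u γ₀ : ℝ) :
    HasSum (fun k : ℤ ↦
      (‖weilMellin (fun t ↦ h t * cexp (-(γ₀ * I) * t))
          (1 / 2 + u + ((γ₀ + 2 * π * k / T : ℝ) : ℂ) * I)‖ ^ 2 +
        ‖weilMellin (fun t ↦ h t * cexp (-(γ₀ * I) * t))
          (1 - conj (1 / 2 + u + ((γ₀ + 2 * π * k / T : ℝ) : ℂ) * I))‖ ^ 2 -
        ‖weilMellin (fun t ↦ h t * cexp (-(γ₀ * I) * t))
            (1 / 2 + u + ((γ₀ + 2 * π * k / T : ℝ) : ℂ) * I) -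
          weilMellin (fun t ↦ h t * cexp (-(γ₀ * I) * t))
            (1 - conj (1 / 2 + u + ((γ₀ + 2 * π * k / T : ℝ) : ℂ) * I))‖ ^ 2) -
      2 * ‖weilMellin (fun t ↦ h t * cexp (-(γ₀ * I) * t))
          (1 / 2 + ((γ₀ + 2 * π * k / T : ℝ) : ℂ) * I)‖ ^ 2)
      (2 * T * ∑ d ∈ Finset.Icc (-(2 * N : ℤ)) (2 * N),
        (Real.exp (-(u * d * T)) - 1) * ∫ s : ℝ, (h s * conj (h (s + d * T))).re) := by
  have Hu := (hasSum_re_weilMellin_pair_fence_lags hh hsupp hT N haN u γ₀).mul_left 2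
  have H0 := (hasSum_re_weilMellin_pair_fence_lags hh hsupp hT N haN 0 γ₀).mul_left 2
  have H := Hu.sub H0
  have eL : (fun k : ℤ ↦
      (‖weilMellin (fun t ↦ h t * cexp (-(γ₀ * I) * t))
          (1 / 2 + u + ((γ₀ + 2 * π * k / T : ℝ) : ℂ) * I)‖ ^ 2 +
        ‖weilMellin (fun t ↦ h t * cexp (-(γ₀ * I) * t))
          (1 - conj (1 / 2 + u + ((γ₀ + 2 * π * k / T : ℝ) : ℂ) * I))‖ ^ 2 -
        ‖weilMellin (fun t ↦ h t * cexp (-(γ₀ * I) * t))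
            (1 / 2 + u + ((γ₀ + 2 * π * k / T : ℝ) : ℂ) * I) -
          weilMellin (fun t ↦ h t * cexp (-(γ₀ * I) * t))
            (1 - conj (1 / 2 + u + ((γ₀ + 2 * π * k / T : ℝ) : ℂ) * I))‖ ^ 2) -
      2 * ‖weilMellin (fun t ↦ h t * cexp (-(γ₀ * I) * t))
          (1 / 2 + ((γ₀ + 2 * π * k / T : ℝ) : ℂ) * I)‖ ^ 2) =
      fun k : ℤ ↦ 2 * (weilMellin (fun t ↦ h t * cexp (-(γ₀ * I) * t))
            (1 / 2 + u + ((γ₀ + 2 * π * k / T : ℝ) : ℂ) * I) *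
          conj (weilMellin (fun t ↦ h t * cexp (-(γ₀ * I) * t))
            (1 - conj (1 / 2 + u + ((γ₀ + 2 * π * k / T : ℝ) : ℂ) * I)))).re -
        2 * (weilMellin (fun t ↦ h t * cexp (-(γ₀ * I) * t))
            (1 / 2 + (0 : ℝ) + ((γ₀ + 2 * π * k / T : ℝ) : ℂ) * I) *
          conj (weilMellin (fun t ↦ h t * cexp (-(γ₀ * I) * t))
            (1 - conj (1 / 2 + (0 : ℝ) + ((γ₀ + 2 * π * k / T : ℝ) : ℂ) * I)))).re := by
    funext k
    rw [norm_sq_add_norm_sq_sub_norm_sq_sub]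
    congr 1
    rw [one_sub_conj_half_add 0]
    simp only [neg_zero, Complex.ofReal_zero, add_zero]
    rw [Complex.mul_conj, Complex.normSq_eq_norm_sq]
    norm_cast
  have eR : (2 * T * ∑ d ∈ Finset.Icc (-(2 * N : ℤ)) (2 * N),
        (Real.exp (-(u * d * T)) - 1) * ∫ s : ℝ, (h s * conj (h (s + d * T))).re) =
      2 * (T * ∑ d ∈ Finset.Icc (-(2 * N : ℤ)) (2 * N),
        Real.exp (-(u * d * T)) * ∫ s : ℝ, (h s * conj (h (s + d * T))).re) -
      2 * (T * ∑ d ∈ Finset.Icc (-(2 * N : ℤ)) (2 * N),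
        Real.exp (-((0 : ℝ) * d * T)) * ∫ s : ℝ, (h s * conj (h (s + d * T))).re) := by
    simp only [zero_mul, neg_zero, Real.exp_zero, one_mul]
    rw [mul_assoc, ← mul_sub, ← mul_sub, ← Finset.sum_sub_distrib]
    congr 2
    refine Finset.sum_congr rfl fun d _ ↦ ?_
    ring
  rw [eL, eR]
  exact H

end FenceAnatomy

end Summit.RiemannHypothesis.RiemannHypothesis.Theorems
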